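import Summits.Ventures.HSemireg.WedgeHankelRecurrenceHankelEuclid
import Summits.Ventures.HSemireg.WedgeHankelRecurrenceCensusToeplitz

/-!
# Venture HSemireg — THE INVERSE OF A NON-SINGULAR HANKEL MATRIX IS A BEZOUTIAN, AND CONVERSELY (Lander 1974; any field): for `m` monic of degree `t + 1` and `u·a ≡ 1 (mod m)`,
# **`H_t(a/m) · B(u, m) = 1`** and **`B(a, m) · H_t(u/m) = 1`**, so **`H_t(a/m)⁻¹ = B(u, m)`**, **`B(a, m)⁻¹ = H_t(u/m)`**; and EVERY non-singular `(t+1) × (t+1)` Hankel matrix `H_t(s)` is an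
# `H_t(a/m)` with `deg m = t + 1`, `(m, a)` coprime — hence **`det H_t(s) ≠ 0 ⇒ ∃ m` monic of degree `t + 1`, `u` of degree `≤ t`: `H_t(s)⁻¹ = B(u, m)`**

HONEST FRAMING. Part of the Lean index of the computation cell `pub-hsemireg` (seat p10 gen 37, Sunday typer «UNIFORM-IN-n»).
LINEAR ALGEBRA OF HANKEL ∕ BEZOUTIAN MATRICES OVER A FIELD ONLY (PROVED Literature `LinearAlgebra/Matrix/Bezoutian` through N141; the lineage's `mulResidueMat`, `dualSeq`, `recSpace`): no variety,
no cohomology theory, no sheaf, no Ext group and no semiregularity map is constructed here; nothing here says that HC / HC_CM / HC_AV holds; no Literature fact (unproved `Prop`) is declared or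
used.  Custodian versions as in `WedgeHankelSiegelIdeal` (1/3).
SOURCE OF THE ARGUMENT (cited): F. I. Lander, *The Bezoutian and the inversion of Hankel and Toeplitz matrices*, Mat. Issled. 9 (1974) 69–87; G. Heinig, K. Rost, *Algebraic Methods for
Toeplitz-like Matrices and Operators* (1984) §1; the inversion items of D. S. Bernstein, *Matrix Mathematics* (2009) Fact 4.8.6 which Literature `Bezoutian.lean` lists as «Not formalized: … the
Hankel-inverse items»; the algebra used is BPR (2006) Prop. 9.20 ∕ N141 (`B(a, m) = M_a B(1, m)`, `H_t(1/m) B(1, m) = 1`, `H_t(a/m) = H_t(1/m) M_a`) plus `M_a M_u = M_{au mod m} = 1`.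
DEDUP DISCLOSURE (`rg` of the whole tree + Mathlib, 2026-09-01): N141 has `H_t(1/m) · B(1, m) = 1` (the case `a = u = 1`) and the congruence `H_t(a/m) = H_t(1/m) B(a,m) H_t(1/m)`; Literature
`Bezoutian` has `isUnit_bezoutian_iff_isCoprime` but no inverse formula; N97 ∕ N32 the rationality of recurrent sequences; nothing in the tree inverts a general Hankel matrix or a Bezoutian —
that is this file.  10 names: 0 hits tree-wide.

WHAT IS IN THE TREE.  N141 (`…Bezoutian`): **`bezoutian_eq_mulResidueMat_mul`** (Barnett), **`hankelSq_charSeq_mul_bezoutian_one`**, `bezoutian_one_mul_hankelSq_charSeq`; N73 **`hankelSq_dualSeq_eq_mul`**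
(`H_t(a/m) = H_t(1/m) M_a`), `mulResidueMat_apply`, `det_hankelSq_dualSeq_ne_zero_iff`; N91 (`…CompanionAlgebra`) `mulResidueMat_mul`, `mulResidueMat_one`; N32 `exists_dualSeq_of_mem_recSpace`; N18
`mem_recSpace_iff`, `hkFun_eq_sum_range`, `mem_degreeLT_succ_iff`.  Mathlib: `Polynomial.modByMonic_eq_of_dvd_sub`, `modByMonic_add_div`, `modByMonic_eq_sub_mul_div`, `natDegree_modByMonic_lt`,
`Matrix.inv_eq_right_inv`, `Matrix.mul_nonsing_inv`, `Matrix.mulVec_mulVec`.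
THIS FILE (namespace `Summit.Ventures.HSemireg.Wedge.HankelOuter` continued; PLAIN over N164's closure + N49 (tree); 0 definitions):
* §823 `mulResidueMat_congr_of_dvd_sub`, **`mulResidueMat_mul_eq_one_of_modByMonic`** (`u a ≡ 1 ⇒ M_a M_u = M_u M_a = 1`), `exists_modByMonic_mul_eq_one_of_isCoprime` (coprime ⇒ a modular inverse of
  degree `≤ t`).
* §824 **`hankelSq_dualSeq_mul_bezoutian_eq_one`** (`H_t(a/m) B(u,m) = 1`), **`bezoutian_mul_hankelSq_dualSeq_eq_one`** (`B(a,m) H_t(u/m) = 1`), **`inv_hankelSq_dualSeq_eq_bezoutian`**,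
  **`inv_bezoutian_eq_hankelSq_dualSeq`**.
* §825 LANDER: `exists_hankelSq_eq_hankelSq_dualSeq_of_det_ne_zero` (a non-singular `H_t(s)` is `H_t(a/m)` with `deg m = t + 1`), **`exists_inv_hankelSq_eq_bezoutian`** (`det H_t(s) ≠ 0 ⇒ H_t(s)⁻¹ =
  B(u, m)`), `exists_inv_bezoutian_eq_hankelSq` (a non-singular Bezoutian has a Hankel inverse), `exists_inv_toeplitzSq_eq_submatrix_bezoutian` (Toeplitz reading `T_t(s)⁻¹ = J · B(u, m)`, N49).
CAVEATS.  `m` MONIC of degree exactly the size `t + 1` (the lineage's `dualSeq`); the explicit Gohberg–Semencul FORMULA (inverse from the first and last columns) is NOT typed.  Nothing Ext-side.  New names only.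
-/

open Module Polynomial
open scoped Matrix Polynomial

namespace Summit.Ventures.HSemireg.Wedge.HankelOuter

open Summit.Ventures.HSemireg.Wedge Summit.Ventures.HSemireg.Wedge.Hankel
open Literature.LinearAlgebra.Matrix.Bezoutian (bezoutian bezoutian_apply bezoutian_one_left_apply)

section Inverse

variable {K : Type*} [Field K]

/-! ## §823. Modular inverses and multiplication matrices: `u a ≡ 1 (mod m)` makes `M_a`, `M_u` inverse to each other -/

/-- `M_p` only depends on `p mod m`: `m ∣ p − p' ⇒ M_p = M_{p'}`. [bookkeeping] -/
theorem mulResidueMat_congr_of_dvd_sub {t : ℕ} {m : K[X]} (hm : m.Monic) {p p' : K[X]} (h : m ∣ p - p') : mulResidueMat K t m p = mulResidueMat K t m p' := by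
  ext k j
  rw [mulResidueMat_apply, mulResidueMat_apply, Polynomial.modByMonic_eq_of_dvd_sub hm (by rw [← mul_sub]; exact h.mul_left _)]

/-- **`u·a ≡ 1 (mod m)` ⇒ `M_a · M_u = 1` and `M_u · M_a = 1`** (`m` monic of degree `t + 1`; N91 `M_{ab} = M_a M_b`, `M_1 = 1`). [this file, §823] -/
theorem mulResidueMat_mul_eq_one_of_modByMonic {t : ℕ} {m : K[X]} (hm : m.Monic) (hmd : m.natDegree = t + 1) {a u : K[X]} (hua : (u * a) %ₘ m = 1) :
    mulResidueMat K t m a * mulResidueMat K t m u = 1 ∧ mulResidueMat K t m u * mulResidueMat K t m a = 1 := by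
  have hdiv := Polynomial.modByMonic_add_div (u * a) m
  rw [hua] at hdiv
  have hdvd : m ∣ u * a - 1 := ⟨(u * a) /ₘ m, by linear_combination -hdiv⟩
  have key : mulResidueMat K t m (u * a) = 1 := by rw [mulResidueMat_congr_of_dvd_sub hm hdvd, mulResidueMat_one K hm hmd]
  refine ⟨?_, ?_⟩
  · rw [← mulResidueMat_mul K hm hmd, mul_comm, key]
  · rw [← mulResidueMat_mul K hm hmd, key]

/-- From coprimality a modular inverse of degree `≤ t`: `IsCoprime m a ⇒ ∃ u, deg u ≤ t ∧ u·a ≡ 1 (mod m)` (`m` monic of degree `t + 1`). [this file, §823] -/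
theorem exists_modByMonic_mul_eq_one_of_isCoprime {t : ℕ} {m : K[X]} (hm : m.Monic) (hmd : m.natDegree = t + 1) {a : K[X]} (hc : IsCoprime m a) :
    ∃ u : K[X], u.natDegree ≤ t ∧ (u * a) %ₘ m = 1 := by
  obtain ⟨c, d, hcd⟩ := hc
  have hm1 : m ≠ 1 := fun h => by rw [h, Polynomial.natDegree_one] at hmd; omega
  refine ⟨d %ₘ m, Nat.le_of_lt_succ ((Polynomial.natDegree_modByMonic_lt d hm hm1).trans_eq hmd), ?_⟩
  have h1 : m ∣ d %ₘ m * a - d * a := by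
    rw [← sub_mul, Polynomial.modByMonic_eq_sub_mul_div d m]; exact ⟨-(d /ₘ m) * a, by ring⟩
  have h2 : m ∣ d * a - 1 := ⟨-c, by linear_combination hcd⟩
  have h3 : (1 : K[X]) %ₘ m = 1 :=
    (Polynomial.modByMonic_eq_self_iff hm).2 (by rw [Polynomial.degree_one, Polynomial.degree_eq_natDegree hm.ne_zero, hmd]; exact_mod_cast Nat.succ_pos t)
  rw [Polynomial.modByMonic_eq_of_dvd_sub hm h1, Polynomial.modByMonic_eq_of_dvd_sub hm h2, h3]

/-! ## §824. `H_t(a/m) · B(u, m) = 1` and `B(a, m) · H_t(u/m) = 1` for `u a ≡ 1 (mod m)`: Hankel matrices and Bezoutians are each other's inverses -/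

/-- **`H_t(a/m) · B(u, m) = 1`** for `m` monic of degree `t + 1`, `u·a ≡ 1 (mod m)`, `deg u ≤ t + 1` (N73 `H_t(a/m) = H_t(1/m) M_a`, N141 Barnett `B(u,m) = M_u B(1,m)` and `H_t(1/m) B(1,m) = 1`).
[this file, §824] -/
theorem hankelSq_dualSeq_mul_bezoutian_eq_one {t : ℕ} {m : K[X]} (hm : m.Monic) (hmd : m.natDegree = t + 1) {a u : K[X]} (hua : (u * a) %ₘ m = 1) (hu : u.natDegree ≤ t + 1) :
    hankelSq K t (dualSeq K m a) * bezoutian (t + 1) u m = 1 := by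
  rw [hankelSq_dualSeq_eq_mul K hm hmd a, bezoutian_eq_mulResidueMat_mul K hm hmd hu, Matrix.mul_assoc, ← Matrix.mul_assoc (mulResidueMat K t m a), (mulResidueMat_mul_eq_one_of_modByMonic hm hmd hua).1,
    Matrix.one_mul, hankelSq_charSeq_mul_bezoutian_one K hm hmd]

/-- **`B(a, m) · H_t(u/m) = 1`** for `m` monic of degree `t + 1`, `u·a ≡ 1 (mod m)`, `deg a ≤ t + 1`. [this file, §824] -/
theorem bezoutian_mul_hankelSq_dualSeq_eq_one {t : ℕ} {m : K[X]} (hm : m.Monic) (hmd : m.natDegree = t + 1) {a u : K[X]} (hua : (u * a) %ₘ m = 1) (ha : a.natDegree ≤ t + 1) :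
    bezoutian (t + 1) a m * hankelSq K t (dualSeq K m u) = 1 := by
  rw [hankelSq_dualSeq_eq_mul K hm hmd u, bezoutian_eq_mulResidueMat_mul K hm hmd ha, Matrix.mul_assoc, ← Matrix.mul_assoc (bezoutian (t + 1) 1 m), bezoutian_one_mul_hankelSq_charSeq K hm hmd, Matrix.one_mul,
    (mulResidueMat_mul_eq_one_of_modByMonic hm hmd hua).1]

/-- **THE INVERSE OF THE HANKEL MATRIX `H_t(a/m)` IS THE BEZOUTIAN `B(u, m)` of the modular inverse `u` of `a`** (`m` monic of degree `t + 1`; Lander's theorem ∕ Bernstein Fact 4.8.6 in the rational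
case). [this file, §824] -/
theorem inv_hankelSq_dualSeq_eq_bezoutian {t : ℕ} {m : K[X]} (hm : m.Monic) (hmd : m.natDegree = t + 1) {a u : K[X]} (hua : (u * a) %ₘ m = 1) (hu : u.natDegree ≤ t + 1) :
    (hankelSq K t (dualSeq K m a))⁻¹ = bezoutian (t + 1) u m :=
  Matrix.inv_eq_right_inv (hankelSq_dualSeq_mul_bezoutian_eq_one hm hmd hua hu)

/-- **THE INVERSE OF THE BEZOUTIAN `B(a, m)` IS THE HANKEL MATRIX `H_t(u/m)`**, `u` the modular inverse of `a` (`m` monic of degree `t + 1`, `deg a ≤ t + 1`). [this file, §824] -/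
theorem inv_bezoutian_eq_hankelSq_dualSeq {t : ℕ} {m : K[X]} (hm : m.Monic) (hmd : m.natDegree = t + 1) {a u : K[X]} (hua : (u * a) %ₘ m = 1) (ha : a.natDegree ≤ t + 1) :
    (bezoutian (t + 1) a m)⁻¹ = hankelSq K t (dualSeq K m u) :=
  Matrix.inv_eq_right_inv (bezoutian_mul_hankelSq_dualSeq_eq_one hm hmd hua ha)

/-! ## §825. LANDER'S THEOREM: the inverse of EVERY non-singular Hankel matrix is a Bezoutian -/

/-- **Every non-singular Hankel matrix is the Hankel matrix of a proper fraction with denominator of degree EXACTLY its size: `det H_t(s) ≠ 0 ⇒ ∃ m` monic of degree `t + 1`, `a` with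
`H_t(s) = H_t(a/m)`** (solve `H_t(s) x = −(s_{t+1}, …, s_{2t}, 0)` for the lower coefficients of `m`; then `m ∈ Rec^{2t}_{t+1}(s)` and N32 supplies the numerator). [this file, §825] -/
theorem exists_hankelSq_eq_hankelSq_dualSeq_of_det_ne_zero {t : ℕ} (s : ℕ → K) (hdet : (hankelSq K t s).det ≠ 0) :
    ∃ m a : K[X], m.Monic ∧ m.natDegree = t + 1 ∧ a ∈ Polynomial.degreeLT K (t + 1) ∧ ∀ j, j ≤ 2 * t → s j = dualSeq K m a j := by
  classical
  -- the lower coefficients of `m`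
  set v : Fin (t + 1) → K := fun j => -(if (j : ℕ) + t + 1 ≤ 2 * t then s ((j : ℕ) + t + 1) else 0) with hvdef
  have hunit : IsUnit (hankelSq K t s) := (Matrix.isUnit_iff_isUnit_det _).2 (isUnit_iff_ne_zero.2 hdet)
  set x : Fin (t + 1) → K := (hankelSq K t s)⁻¹ *ᵥ v with hxdef
  have hx : hankelSq K t s *ᵥ x = v := by rw [hxdef, Matrix.mulVec_mulVec, Matrix.mul_nonsing_inv _ ((Matrix.isUnit_iff_isUnit_det _).1 hunit), Matrix.one_mulVec]
  set m : K[X] := Polynomial.X ^ (t + 1) + ∑ i : Fin (t + 1), Polynomial.C (x i) * Polynomial.X ^ (i : ℕ) with hmdef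
  have hlow : (∑ i : Fin (t + 1), Polynomial.C (x i) * Polynomial.X ^ (i : ℕ)).degree < ((t + 1 : ℕ) : WithBot ℕ) := by
    refine (Polynomial.degree_sum_le _ _).trans_lt ((Finset.sup_lt_iff (by exact_mod_cast WithBot.bot_lt_coe (t + 1))).2 fun i _ => ?_)
    exact (Polynomial.degree_C_mul_X_pow_le _ _).trans_lt (by exact_mod_cast i.isLt)
  have hm : m.Monic := by
    rw [hmdef, Polynomial.Monic, add_comm, Polynomial.leadingCoeff_add_of_degree_lt (by rwa [Polynomial.degree_X_pow]), Polynomial.leadingCoeff_X_pow]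
  have hmd : m.natDegree = t + 1 := by
    rw [hmdef, add_comm, Polynomial.natDegree_add_eq_right_of_degree_lt (by rwa [Polynomial.degree_X_pow]), Polynomial.natDegree_X_pow]
  have hcoeff : ∀ (i : ℕ) (hi : i ≤ t), m.coeff i = x ⟨i, Nat.lt_succ_of_le hi⟩ := fun i hi => by
    rw [hmdef, Polynomial.coeff_add, Polynomial.coeff_X_pow, if_neg (by omega), zero_add, Polynomial.finsetSum_coeff,
      Finset.sum_eq_single (⟨i, by omega⟩ : Fin (t + 1)) (fun b _ hb => by rw [Polynomial.coeff_C_mul_X_pow, if_neg (fun h => hb (Fin.ext h.symm))]) (fun h => absurd (Finset.mem_univ _) h),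
      Polynomial.coeff_C_mul_X_pow, if_pos rfl]
  -- `m` annihilates the windows `j ≤ t − 1` of `s`
  have htop : m.coeff (t + 1) = 1 := by rw [← hmd]; exact hm.coeff_natDegree
  have hrec : m ∈ recSpace K (2 * t) s m.natDegree := by
    rw [hmd, mem_recSpace_iff]
    refine ⟨(mem_degreeLT_succ_iff K).2 hmd.le, fun j hj => ?_⟩
    rw [hkFun_eq_sum_range K s j (show m.natDegree < t + 2 by omega), Finset.sum_range_succ, ← Fin.sum_univ_eq_sum_range (fun i => m.coeff i * s (i + j)) (t + 1)]
    have hrow := congrFun hx ⟨j, by omega⟩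
    rw [Matrix.mulVec, dotProduct] at hrow
    simp only [hankelSq, Matrix.of_apply, hvdef] at hrow
    rw [if_pos (show j + t + 1 ≤ 2 * t by omega)] at hrow
    have hsum : ∑ i : Fin (t + 1), m.coeff (i : ℕ) * s ((i : ℕ) + j) = ∑ i : Fin (t + 1), s (j + (i : ℕ)) * x i :=
      Finset.sum_congr rfl fun i _ => by rw [hcoeff i (Nat.le_of_lt_succ i.isLt), add_comm (i : ℕ) j, mul_comm]
    rw [hsum, hrow, htop, one_mul, show t + 1 + j = j + t + 1 by omega, neg_add_cancel]
  obtain ⟨a, ha, hqa⟩ := exists_dualSeq_of_mem_recSpace K hm hrec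
  exact ⟨m, a, hm, hmd, hmd ▸ ha, hqa⟩

/-- **LANDER'S THEOREM: the inverse of a non-singular Hankel matrix is a Bezoutian** — for every sequence `s` over a field and size `t + 1` with `det H_t(s) ≠ 0` there are `m` monic of degree `t + 1`
and `u` of degree `≤ t` with `H_t(s)⁻¹ = B(u, m)` (and `H_t(s) · B(u, m) = 1`): `H_t(s) = H_t(a/m)` by §825, `(m, a)` coprime since the form is non-singular (N73), `u = a⁻¹ mod m` (§823), and
§824. [this file, §825] -/
theorem exists_inv_hankelSq_eq_bezoutian {t : ℕ} (s : ℕ → K) (hdet : (hankelSq K t s).det ≠ 0) :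
    ∃ m u : K[X], m.Monic ∧ m.natDegree = t + 1 ∧ u.natDegree ≤ t ∧ hankelSq K t s * bezoutian (t + 1) u m = 1 ∧ (hankelSq K t s)⁻¹ = bezoutian (t + 1) u m := by
  classical
  obtain ⟨m, a, hm, hmd, -, hs⟩ := exists_hankelSq_eq_hankelSq_dualSeq_of_det_ne_zero s hdet
  have hH : hankelSq K t s = hankelSq K t (dualSeq K m a) := by
    ext i j; simp only [hankelSq, Matrix.of_apply]; exact hs _ (by have := i.isLt; have := j.isLt; omega)
  have hc : IsCoprime m a := (det_hankelSq_dualSeq_ne_zero_iff K hm hmd a).1 (by rw [← hH]; exact hdet)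
  obtain ⟨u, hu, hua⟩ := exists_modByMonic_mul_eq_one_of_isCoprime hm hmd hc
  exact ⟨m, u, hm, hmd, hu, by rw [hH]; exact hankelSq_dualSeq_mul_bezoutian_eq_one hm hmd hua (by omega), by rw [hH]; exact inv_hankelSq_dualSeq_eq_bezoutian hm hmd hua (by omega)⟩

/-- **… and conversely the inverse of a non-singular Bezoutian `B(a, m)` (`m` monic of degree `t + 1`, `deg a ≤ t + 1`) is the Hankel matrix `H_t(u/m)`, `u = a⁻¹ mod m`** (non-singular ⟺
`(m, a)` coprime, Literature `isUnit_det_bezoutian_iff_isCoprime` ∕ N141). [this file, §825] -/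
theorem exists_inv_bezoutian_eq_hankelSq {t : ℕ} {m : K[X]} (hm : m.Monic) (hmd : m.natDegree = t + 1) {a : K[X]} (ha : a.natDegree ≤ t + 1) (hc : IsCoprime m a) :
    ∃ u : K[X], u.natDegree ≤ t ∧ bezoutian (t + 1) a m * hankelSq K t (dualSeq K m u) = 1 ∧ (bezoutian (t + 1) a m)⁻¹ = hankelSq K t (dualSeq K m u) := by
  obtain ⟨u, hu, hua⟩ := exists_modByMonic_mul_eq_one_of_isCoprime hm hmd hc
  exact ⟨u, hu, bezoutian_mul_hankelSq_dualSeq_eq_one hm hmd hua ha, inv_bezoutian_eq_hankelSq_dualSeq hm hmd hua ha⟩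

/-- **… and the Toeplitz reading: the inverse of a non-singular TOEPLITZ matrix `T_t(s) = H_t(s) · J` is a column-reversed Bezoutian, `T_t(s)⁻¹ = J · B(u, m)`** (N49 `toeplitzSq = hankelSq
re-indexed by the reversal`; the Gohberg–Semencul shape). [this file, §825] -/
theorem exists_inv_toeplitzSq_eq_submatrix_bezoutian {t : ℕ} (s : ℕ → K) (hdet : (toeplitzSq K t s).det ≠ 0) :
    ∃ m u : K[X], m.Monic ∧ m.natDegree = t + 1 ∧ u.natDegree ≤ t ∧ (toeplitzSq K t s)⁻¹ = (bezoutian (t + 1) u m).submatrix (Fin.revPerm : Equiv.Perm (Fin (t + 1))) id := by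
  obtain ⟨m, u, hm, hmd, hu, -, hinv⟩ := exists_inv_hankelSq_eq_bezoutian s ((det_toeplitzSq_ne_zero_iff K t s).1 hdet)
  refine ⟨m, u, hm, hmd, hu, ?_⟩
  rw [toeplitzSq_eq_submatrix, show (hankelSq K t s).submatrix id ⇑(Fin.revPerm : Equiv.Perm (Fin (t + 1))) = (hankelSq K t s).submatrix ⇑(Equiv.refl (Fin (t + 1))) ⇑(Fin.revPerm : Equiv.Perm (Fin (t + 1))) from rfl,
    Matrix.inv_submatrix_equiv, hinv]
  rfl

end Inverse

end Summit.Ventures.HSemireg.Wedge.HankelOuter
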